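import Summits.QuantumFields.YangMills.Theorems.BalabanUVNodesN22WindowedNE9OfCouplingHolo

/-!
# BalabanUVNodes ∕ node N22 = NE9 — PRINT's DICHOTOMY IN KERNEL CURRENCY: the (β′) letter `WindowedNE9 F (localizedSum F S emb) …` from
# ACTIVITY-level coupling holomorphy in the OLDER couplings only + an OUTPUT-level Lipschitz letter (or `EHoloAt`-shape datum) in the LAST coupling
# — no activity-level slot in the last coupling remains

Cell `pub-ymgap`, HUMAN RULING D-0062 (Track A), R134 seat `pub-ymgap-dag-n22-c` (strategy s1: «the history-Lipschitz estimate (2.40)–(2.41) p. 21 of [II] on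
the W1 object»), generation 13, module J33.  THEOREMS ONLY (no `def`, no `def … : Prop`, no `sorry`); imports this lane's J32′
`…Theorems.BalabanUVNodesN22WindowedNE9OfCouplingHolo` (p607237; through it J29 ∕ J30 ∕ J31 ∕ J31b, dag-n22-w2's soft-road capstone engine
`windowedNE9_localizedSum_of_softSum` (p599486 ∕ p602050) and node00-def-W1's objects) — everything consumed BY NAME.  Filed `--supports stmt-QuantumFields-20544`
(K3⁷ `SpineGivenEndpointR13SepCoPH`) as a HELPER.

WHY (print's dichotomy, [II] p. 12 (2.3) and [I] p. 263).  The small-field cut-off `χ(|B(b)| < ε₁∕g_k)` of the `k`-th step reads the LAST coupling `g_k` only; an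
OLDER coupling `g_i`, `i < k`, enters the activities (2.14) p. 15 only through the potentials of the earlier actions — so complexifying an OLDER coupling at
ACTIVITY level meets no cut-off (node N10's Lemmas 1–3 «(or analytic)» in those couplings), while the LAST coupling's printed regularity is an OUTPUT-level
clause: [I] p. 263 *«It is a C^∞-function of g_{j−1} ∈ [0, γ], (or analytic)»* about `E^{(j)}`, delivered per step by node N09 (`B12BetaHolo.EHoloAt`: the new
term holomorphic in its last coupling on a uniform margin about `[0, γ]` with (1.18) there).  This seat's generation 0 typed the dichotomy in the old sup-letter
currency (`…N22ActivityStripMixed`, p455244).  The KERNEL-currency road of record (plan g81 ruling (β): J27–J32′, dag-n22-w2's (A) p605956 ∕ (B) p606885,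
dag-n22-w5's p608801) still reads an ACTIVITY-level slot in the last coupling — `YoungLipschitz` on the full box, or J31's uniform last-coupling margin, or
J31b's relative-disc vertex datum.  THIS FILE removes it: the (β′) letter `WindowedNE9 F (localizedSum F S emb) …` (and J29's law (N) under it) from
printed `Bound238` on the box (N10 (2.38)) + coupling-holomorphy margin data in the OLDER coordinates ONLY + an OUTPUT-level last-coupling Lipschitz
letter `‖E^{(k+1)}(X; g; φ) − E^{(k+1)}(X; g|g_k := t; φ)‖ ≤ Λ_E e^{−κ d_{k+1}(X)}|g_k − t|`, which §3 derives from an `EHoloAt`-shape datum (uniform discs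
about `]0, γ]` at OUTPUT level, Cauchy) and, vertex-aware, from print's dilation shape at OUTPUT level (relative discs `D̄(s, c·s)`, bound linear in `s`).

MECHANISM.  Telescoping split at the last coordinate: `E(hist) − E(hist′) = [E(hist) − E(hist|_k := hist′_k)] + [E(hist|_k := hist′_k) − E(hist′)]`; the
first bracket is the output-level letter; the two prefixes of the second AGREE at the last coordinate, so J30's engine `norm_clusterStepE_sub_le_of_youngLipschitz`
runs on the prefix set PINNED at that value, where W1's `YoungLipschitz` follows from the older-coordinate margin data alone (§1: J31's telescoping
`norm_sub_le_sum_of_coordLipschitz` on the product `]0,γ]^k × {c}` with the Cauchy letters `norm_sub_update_le_of_coordHolo` in the older coordinates and the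
trivial letter in the pinned one).

WHAT (0 `def`, 0 `sorry`).
* §1 `youngLipschitz_pinLast_of_olderCoordHolo` — older margin data on `box γ k` ⟹ `YoungLipschitz` on `{g ∈ box γ k | g_k = c}` with table `4A∕ϱ_i`.
* §2 ★ `norm_clusterStepE_sub_le_of_olderCoordHolo_lastLetter` — law (N) at E-level for two box prefixes and every configuration admissible inside `X`:
  `‖E^{(k+1)}(X;hist;φ) − E^{(k+1)}(X;hist′;φ)‖ ≤ e^{−κ d_{k+1}(X)}·Σ_i Λ_i|hist_i − hist′_i|` for ANY table `Λ` dominating `c₀·4A∕ϱ_i` (`i < k`,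
  `c₀ = 8·e·9·64·K₀(64,8)²`) and `Λ_E` (`i = k`).
* §3 `lastLetter_of_lastOutputHolo` (N09-shape: uniform `r_E`-discs about `]0,γ]` at E-level, bound `B e^{−κ_E d}`, `κ ≤ κ_E` ⟹ `Λ_E = 4B∕r_E`;
  `Dimock2015.real_param_lipschitz` via J31 §2) · `lastLetter_of_lastOutputHoloRel` (relative discs `D̄(s, c·s)`, bound `B′ s e^{−κ_E d}` ⟹ `Λ_E = 8B′∕min(c,1)`;
  `T4CouplingAnalyticity.real_param_lipschitz_relW` via J31b §1) · A5 rider `lastLetter_termlessStep`.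
* §4 `dichotomySummand_le_softMajorant` (real arithmetic) · `abs_polWindow_localizedSum_sub_le_soft_of_dichotomy` — J29's soft windowed bound with (N) from §2 at
  `φ := Φ_X z` and (C1) from activity holomorphy through the reading (J30 v1.1).
* THE (β′) LETTER ITSELF (`WindowedNE9 F (localizedSum F S emb) …` with moduli `C·Λ^D`, `Λ^D n i = if i + 1 < n then c₀·4A∕ϱt n i else Λ_E`) is the sibling
  file `…N22WindowedNE9DichotomyLetter` (the 400-line cap): §4 composed with dag-n22-w2's `windowedNE9_localizedSum_of_softSum` BY NAME.

HONEST FRAMING.  Count-neutral helper ∕ junction; the ONLY estimates used are Road 1's elementary engine and the two Cauchy lemmas already in the tree.  DISPLAYED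
(hypotheses), with owners: printed (2.38) `Bound238` on the boxes (node N10's Lemma 3); the older-coordinate ACTIVITY margin data (N10's T-row complexified in the
older couplings ∕ NODE A at the towers of record); the OUTPUT-level last-coupling letter ∕ datum (node N09's `EHoloAt` family at the towers of record — the instance is
one `exact` in N09's currency as in dag-n22-d's p452370 and this seat's `…N22W1StripOnDomain` §3, not typed here; the relative edition is the cell's reading of print's
dilation, NOT a printed estimate); activity holomorphy through the complexified readings, the readings, tails and numerals exactly as in (A).  Nothing of Bałaban's is
constructed; N22 NOT discharged (typed 28∕28 · discharged 5∕27 UNCHANGED); K3⁷ OPEN; NE9 NOT IN PRINT for d = 4; one finite four-torus programme at fixed ε — NOT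
infinite volume, NOT OS on ℝ⁴, NOT a mass gap, NOT Clay.  0 `sorry`, 0 `def`, standard axioms.

References (TYPES only): [I] = [Balaban1987RG1] T. Bałaban, Commun. Math. Phys. **109** (1987) 249–301 — §1 p. 263 (clause before (1.18)), (1.20)–(1.21) p. 264,
(4.35)–(4.37) pp. 290–291, (5.10) p. 293; [II] = [Balaban1988RG2Cluster] Commun. Math. Phys. **116** (1988) 1–22 — (2.3) p. 12, (2.13)–(2.14) pp. 14–15, Lemma 3
(2.38) p. 20, (2.39)–(2.41) p. 21; Cauchy mechanisms [Dimock2015] §7 ∕ [DimockYuan2024GNFlow] Thm 4 as typed in `Dimock2015.AnalyticLipschitz` and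
`T4CouplingAnalyticity`.
-/

noncomputable section

open Filter Topology Set Metric
open scoped BigOperators

namespace YMDAG.N22.Dichotomy

open Literature.MathematicalPhysics.QuantumFieldTheory.Balaban1983to89
open Literature.MathematicalPhysics.QuantumFieldTheory.Balaban1983to89.T4Continuum (T4Family)
open Literature.MathematicalPhysics.QuantumFieldTheory.Balaban1983to89.T4OutputRate (Window)
open Literature.MathematicalPhysics.QuantumFieldTheory.Balaban1983to89.TreeLengthTorus (TPt torusTreeLen torusTreeLen_nonneg)
open Literature.MathematicalPhysics.QuantumFieldTheory.Balaban1983to89.B12TreeDecay (K₀ kappa₀ K₀_pos)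
open Literature.MathematicalPhysics.QuantumFieldTheory.Balaban1983to89.B12PolarizationTensor120 (expChart expChart_apply)
open Literature.MathematicalPhysics.QuantumFieldTheory.Balaban1983to89.B12Decay510 (delta1)
open Literature.MathematicalPhysics.QuantumFieldTheory.Balaban1983to89.B12Decay510Window (K₁)
open Literature.MathematicalPhysics.QuantumFieldTheory.Balaban1983to89.B12Decay510Torus (distCT nearT)
open Literature.MathematicalPhysics.QuantumFieldTheory.Balaban1983to89.Node00
open Literature.MathematicalPhysics.QuantumFieldTheory.Balaban1983to89.Node00.Sect2 (domSys domCount CPair)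
open Literature.MathematicalPhysics.QuantumFieldTheory.Balaban1983to89.Node00.W1
open Literature.MathematicalPhysics.QuantumFieldTheory.Balaban1983to89.Node00.LocalizedSum17 (localizedSum ReadingMaps)
open Literature.MathematicalPhysics.QuantumFieldTheory.Balaban1983to89.Node00.U3OfKernels (histPrefix histPrefix_apply)
open Literature.MathematicalPhysics.QuantumFieldTheory.Balaban1983to89.Node00.U3KernelLetters (WindowedNE9)
open YMDAG.N22.W1 (norm_sub_le_sum_of_coordLipschitz norm_sub_update_le_of_coordHolo norm_sub_update_le_of_coordHoloRel)
open YMDAG.N22.WindowOfLocalTerms (norm_clusterStepE_sub_le_of_youngLipschitz differentiableOn_and_norm_clusterStepE_comp_le_of_activityHol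
  abs_polWindow_localizedSum_sub_le_soft)
open YMDAG.N22.WindowSoftTwoPoint (windowedNE9_localizedSum_of_softSum sum_moduli_histPrefix_eq_sum_range)
open YMDAG.N22.WindowedOfCouplingHolo (histPrefix_mem_box)

/-! ## §1 The older-coordinate margin data ⟹ W1's `YoungLipschitz` on the prefix set PINNED at the last coordinate -/

section Step
variable {P : Params} {𝔸 : Type*} {M k : ℕ}

/-- **OLDER MARGINS ⟹ `YoungLipschitz` ON `]0,γ]^k × {c}`.**  For W1's one-step data `S` at level `k` and space tables `sp`: coupling-holomorphy margin data in the
OLDER coordinates `i < k` only (per box prefix `g`, polymer `Z`, `φ ∈ sp Z`: a holomorphic extension of `t ↦ H(Z; g|g_i := t; φ)` to a set containing the closed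
`ϱ_i`-discs about `]0, γ]`, bounded by `A·e^{−R d_{k+1}(Z)}`) give W1's `YoungLipschitz` with the Cauchy table `4A∕ϱ_i` on the set of box prefixes whose LAST
coordinate is pinned at a value `c ∈ ]0, γ]` — on that set no letter in the last coordinate is ever exercised.  J31's `norm_sub_le_sum_of_coordLipschitz` on the
product `]0,γ]^k × {c}` with `norm_sub_update_le_of_coordHolo` in the older coordinates. [cite: Balaban1988RG2Cluster, (2.3) p.12, (2.14) p.15 and Lemma 3 (2.38) p.20; Balaban1987RG1, §2 p.266] -/
theorem youngLipschitz_pinLast_of_olderCoordHolo (S : ClusterStep P 𝔸 M k) {γ : ℝ} (sp : (domSys P M (k + 1)).Dom → Set (CPair P 𝔸))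
    {A R : ℝ} (ϱ : Fin (k + 1) → ℝ) (hϱ : ∀ i, 0 < ϱ i) (hA : 0 ≤ A)
    (hO : ∀ g ∈ box γ k, ∀ (Z : (domSys P M (k + 1)).Dom), ∀ φ ∈ sp Z, ∀ i : Fin (k + 1), (i : ℕ) < k →
      ∃ (Hc : ℂ → ℂ) (O : Set ℂ), DifferentiableOn ℂ Hc O ∧ (∀ t ∈ Ioc (0 : ℝ) γ, closedBall (t : ℂ) (ϱ i) ⊆ O) ∧
        (∀ z ∈ O, ‖Hc z‖ ≤ A * Real.exp (-(R * (domSys P M (k + 1)).dj Z))) ∧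
        (∀ t ∈ Ioc (0 : ℝ) γ, Hc t = S.H (Function.update g i t) φ Z))
    {c : ℝ} (hc : c ∈ Ioc (0 : ℝ) γ) :
    S.YoungLipschitz {g | g ∈ box γ k ∧ g (Fin.last k) = c} sp (fun i => 4 * A / ϱ i) R := by
  intro g hg g' hg' Z φ hφ
  -- the pinned set is the product `]0,γ]^k × {c}`
  obtain ⟨I, hI⟩ : ∃ I : Fin (k + 1) → Set ℝ, I = fun i : Fin (k + 1) => if (i : ℕ) < k then Ioc (0 : ℝ) γ else {c} := ⟨_, rfl⟩
  have hIo : ∀ i : Fin (k + 1), (i : ℕ) < k → I i = Ioc (0 : ℝ) γ := fun i hi => by rw [hI]; exact if_pos hi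
  have hIl : ∀ i : Fin (k + 1), ¬ (i : ℕ) < k → I i = {c} := fun i hi => by rw [hI]; exact if_neg hi
  have hmemI : ∀ g : Fin (k + 1) → ℝ, g ∈ box γ k ∧ g (Fin.last k) = c → ∀ i, g i ∈ I i := by
    intro g hg i
    by_cases hi : (i : ℕ) < k
    · rw [hIo i hi]; exact hg.1 i
    · have hil : i = Fin.last k := by by_contra h; exact hi (Fin.val_lt_last h)
      rw [hIl i hi, mem_singleton_iff, hil]; exact hg.2
  have hboxI : ∀ g : Fin (k + 1) → ℝ, (∀ i, g i ∈ I i) → g ∈ box γ k := by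
    intro g hg i
    by_cases hi : (i : ℕ) < k
    · have h := hg i; rw [hIo i hi] at h; exact h
    · have h := hg i; rw [hIl i hi, mem_singleton_iff] at h; rw [h]; exact hc
  -- the per-coordinate letters: Cauchy in the older coordinates, nothing in the pinned one
  have letters : ∀ g : Fin (k + 1) → ℝ, (∀ i, g i ∈ I i) → ∀ i, ∀ t ∈ I i,
      ‖S.H g φ Z - S.H (Function.update g i t) φ Z‖ ≤ Real.exp (-(R * (domSys P M (k + 1)).dj Z)) * (4 * A / ϱ i) * |g i - t| := by
    intro g hgI i t ht
    by_cases hi : (i : ℕ) < k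
    · rw [hIo i hi] at ht
      have hgi : g i ∈ Ioc (0 : ℝ) γ := by have h := hgI i; rwa [hIo i hi] at h
      obtain ⟨Hc, O, hhol, hdisc, hB, hrep⟩ := hO g (hboxI g hgI) Z φ hφ i hi
      calc ‖S.H g φ Z - S.H (Function.update g i t) φ Z‖
          ≤ 4 * (A * Real.exp (-(R * (domSys P M (k + 1)).dj Z))) / ϱ i * |g i - t| :=
            norm_sub_update_le_of_coordHolo (fun g => S.H g φ Z) Set.ordConnected_Ioc (hϱ i) g i hgi Hc O hhol hdisc hB hrep ht
        _ = Real.exp (-(R * (domSys P M (k + 1)).dj Z)) * (4 * A / ϱ i) * |g i - t| := by ring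
    · rw [hIl i hi, mem_singleton_iff] at ht
      have hgi : g i = c := by have h := hgI i; rwa [hIl i hi, mem_singleton_iff] at h
      have hupd : Function.update g i t = g := by rw [ht, ← hgi]; exact Function.update_eq_self i g
      rw [hupd, sub_self, norm_zero]
      have := (hϱ i).le
      positivity
  have key := norm_sub_le_sum_of_coordLipschitz (fun g => S.H g φ Z) I
    (fun i => Real.exp (-(R * (domSys P M (k + 1)).dj Z)) * (4 * A / ϱ i)) letters (hmemI g hg) (hmemI g' hg')
  calc ‖S.H g φ Z - S.H g' φ Z‖ ≤ ∑ i, Real.exp (-(R * (domSys P M (k + 1)).dj Z)) * (4 * A / ϱ i) * |g i - g' i| := key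
    _ = Real.exp (-(R * (domSys P M (k + 1)).dj Z)) * ∑ i, 4 * A / ϱ i * |g i - g' i| := by
        rw [Finset.mul_sum]
        exact Finset.sum_congr rfl fun i _ => by ring

end Step

/-! ## §2 ★ Law (N) at E-level from printed `Bound238` + OLDER activity margins + an OUTPUT-level last-coupling letter -/

section Engine
variable (F : T4Family) (K : ℕ) {𝔸 : Type*} {M k : ℕ}

open Classical in
/-- ★ **THE DIFFERENCED (2.39)–(2.41) AT THE (2.13) TERM UNDER PRINT's DICHOTOMY.**  For W1's one-step data `S` at level `k` on the `K`-th torus, space tables `sp`,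
the box `]0, γ]^{k+1}` of young-coupling prefixes: printed (2.38) `Bound238 S (box γ k) sp A R` (node N10, DISPLAYED); coupling-holomorphy margin data in the
OLDER coordinates `i < k` (radii `ϱ_i`, bound `A·e^{−R d_{k+1}(Z)}`; N10's T-row complexified — no cut-off is met — DISPLAYED); an OUTPUT-level Lipschitz letter
in the LAST coupling `‖E^{(k+1)}(X; g; φ) − E^{(k+1)}(X; g|g_k := t; φ)‖ ≤ Λ_E·e^{−κ d_{k+1}(X)}·|g_k − t|` on the box, for configurations `φ ∈ sp X` ([I] p. 263 at
OUTPUT level; node N09's `EHoloAt` currency via §3 — DISPLAYED); Road 1's numerals; and ANY nonnegative table `Λ` with `c₀·4A∕ϱ_i ≤ Λ_i` for `i < k`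
(`c₀ = 8·e·9·64·K₀(64,8)²`) and `Λ_E ≤ Λ_k`.  THEN for two box prefixes, every `X ∈ 𝐃_{k+1}` and every configuration admissible inside `X`:
`‖E^{(k+1)}(X; hist; φ) − E^{(k+1)}(X; hist′; φ)‖ ≤ e^{−κ d_{k+1}(X)}·Σ_i Λ_i|hist_i − hist′_i|` — J30's law (N) with NO activity-level slot in the last coupling.
[cite: Balaban1988RG2Cluster, (2.3) p.12, (2.13) p.14, (2.38) p.20 and (2.39)-(2.41) p.21; Balaban1987RG1, §1 p.263] -/
theorem norm_clusterStepE_sub_le_of_olderCoordHolo_lastLetter (S : ClusterStep (F.P K) 𝔸 M k) {γ : ℝ}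
    (sp : (domSys (F.P K) M (k + 1)).Dom → Set (CPair (F.P K) 𝔸)) {A R r₁ κ ΛE : ℝ} (ϱ Λ : Fin (k + 1) → ℝ)
    (hA : 0 < A) (hr₁ : 0 ≤ r₁) (hκ : κ ≤ r₁) (hrate : r₁ + 2 * (64 * Real.log 162) + 2 ≤ R)
    (hsmall : 2 * A * Real.exp (5 * r₁ + 1) * K₀ 64 8 * 9 * 64 ≤ 1) (hϱ : ∀ i, 0 < ϱ i)
    (hΛold : ∀ i : Fin (k + 1), (i : ℕ) < k → 8 * (Real.exp 1 * 9 * 64 * K₀ 64 8 ^ 2) * (4 * A / ϱ i) ≤ Λ i)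
    (hΛlast : ΛE ≤ Λ (Fin.last k))
    (h238 : S.Bound238 (box γ k) sp A R)
    (hO : ∀ g ∈ box γ k, ∀ (Z : (domSys (F.P K) M (k + 1)).Dom), ∀ φ ∈ sp Z, ∀ i : Fin (k + 1), (i : ℕ) < k →
      ∃ (Hc : ℂ → ℂ) (O : Set ℂ), DifferentiableOn ℂ Hc O ∧ (∀ t ∈ Ioc (0 : ℝ) γ, closedBall (t : ℂ) (ϱ i) ⊆ O) ∧
        (∀ z ∈ O, ‖Hc z‖ ≤ A * Real.exp (-(R * (domSys (F.P K) M (k + 1)).dj Z))) ∧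
        (∀ t ∈ Ioc (0 : ℝ) γ, Hc t = S.H (Function.update g i t) φ Z))
    (hlast : ∀ g ∈ box γ k, ∀ t ∈ Ioc (0 : ℝ) γ, ∀ (X : (domSys (F.P K) M (k + 1)).Dom), ∀ φ ∈ sp X,
      ‖S.E g φ X - S.E (Function.update g (Fin.last k) t) φ X‖ ≤ ΛE * Real.exp (-(κ * torusTreeLen X.1)) * |g (Fin.last k) - t|)
    {hist hist' : Fin (k + 1) → ℝ} (hh : hist ∈ box γ k) (hh' : hist' ∈ box γ k) (X : (domSys (F.P K) M (k + 1)).Dom)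
    {φ : CPair (F.P K) 𝔸} (hφ : ∀ Z : (domSys (F.P K) M (k + 1)).Dom, Z.1 ⊆ X.1 → φ ∈ sp Z) :
    ‖S.E hist φ X - S.E hist' φ X‖ ≤ Real.exp (-(κ * torusTreeLen X.1)) * ∑ i, Λ i * |hist i - hist' i| := by
  -- the hybrid prefix: `hist` with its last coordinate moved to `hist′_k`
  obtain ⟨q, hq⟩ : ∃ q : Fin (k + 1) → ℝ, q = Function.update hist (Fin.last k) (hist' (Fin.last k)) := ⟨_, rfl⟩
  have hq_last : q (Fin.last k) = hist' (Fin.last k) := by rw [hq, Function.update_self]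
  have hq_cast : ∀ j : Fin k, q (Fin.castSucc j) = hist (Fin.castSucc j) := fun j => by
    rw [hq, Function.update_of_ne (Fin.castSucc_lt_last j).ne]
  have hqbox : q ∈ box γ k := by
    intro i
    by_cases hi : i = Fin.last k
    · rw [hi, hq_last]; exact hh' _
    · rw [hq, Function.update_of_ne hi]; exact hh i
  -- LAST MOVE, output level: the letter
  have h1 : ‖S.E hist φ X - S.E q φ X‖ ≤ ΛE * Real.exp (-(κ * torusTreeLen X.1)) * |hist (Fin.last k) - hist' (Fin.last k)| := by
    rw [hq]
    exact hlast hist hh _ (hh' _) X φ (hφ X subset_rfl)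
  -- OLDER MOVE, activity level: J30's engine on the pinned set `{g ∈ box | g_k = hist′_k}`
  have hΛ4 : ∀ i : Fin (k + 1), 0 ≤ 4 * A / ϱ i := fun i => by have := hϱ i; have := hA.le; positivity
  have h238W : S.Bound238 {g | g ∈ box γ k ∧ g (Fin.last k) = hist' (Fin.last k)} sp A R := fun g hg => h238 g hg.1
  have hYLW := youngLipschitz_pinLast_of_olderCoordHolo S sp ϱ hϱ hA.le hO (hh' (Fin.last k))
  have h2 : ‖S.E q φ X - S.E hist' φ X‖ ≤ Real.exp (-(κ * torusTreeLen X.1)) *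
      (8 * (Real.exp 1 * 9 * 64 * K₀ 64 8 ^ 2) * ∑ i, 4 * A / ϱ i * |q i - hist' i|) :=
    norm_clusterStepE_sub_le_of_youngLipschitz F K S {g | g ∈ box γ k ∧ g (Fin.last k) = hist' (Fin.last k)} sp (fun i => 4 * A / ϱ i)
      hA hr₁ hκ hrate hsmall hΛ4 h238W hYLW ⟨hqbox, hq_last⟩ ⟨hh', rfl⟩ X hφ
  -- bookkeeping of the two moduli against the dominating table
  have hsum1 : ∑ i, 4 * A / ϱ i * |q i - hist' i| =
      ∑ j : Fin k, 4 * A / ϱ (Fin.castSucc j) * |hist (Fin.castSucc j) - hist' (Fin.castSucc j)| := by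
    rw [Fin.sum_univ_castSucc, hq_last, sub_self, abs_zero, mul_zero, add_zero]
    exact Finset.sum_congr rfl fun j _ => by rw [hq_cast]
  have hsum2 : ∑ i, Λ i * |hist i - hist' i| =
      (∑ j : Fin k, Λ (Fin.castSucc j) * |hist (Fin.castSucc j) - hist' (Fin.castSucc j)|) +
        Λ (Fin.last k) * |hist (Fin.last k) - hist' (Fin.last k)| := by
    rw [Fin.sum_univ_castSucc]
  have hdom : 8 * (Real.exp 1 * 9 * 64 * K₀ 64 8 ^ 2) * (∑ i, 4 * A / ϱ i * |q i - hist' i|) +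
      ΛE * |hist (Fin.last k) - hist' (Fin.last k)| ≤ ∑ i, Λ i * |hist i - hist' i| := by
    rw [hsum1, hsum2, Finset.mul_sum]
    refine add_le_add (Finset.sum_le_sum fun j _ => ?_) (mul_le_mul_of_nonneg_right hΛlast (abs_nonneg _))
    rw [← mul_assoc]
    exact mul_le_mul_of_nonneg_right (hΛold _ j.2) (abs_nonneg _)
  have hexp : 0 ≤ Real.exp (-(κ * torusTreeLen X.1)) := (Real.exp_pos _).le
  calc ‖S.E hist φ X - S.E hist' φ X‖ ≤ ‖S.E hist φ X - S.E q φ X‖ + ‖S.E q φ X - S.E hist' φ X‖ := norm_sub_le_norm_sub_add_norm_sub _ _ _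
    _ ≤ ΛE * Real.exp (-(κ * torusTreeLen X.1)) * |hist (Fin.last k) - hist' (Fin.last k)| +
          Real.exp (-(κ * torusTreeLen X.1)) * (8 * (Real.exp 1 * 9 * 64 * K₀ 64 8 ^ 2) * ∑ i, 4 * A / ϱ i * |q i - hist' i|) :=
        add_le_add h1 h2
    _ = Real.exp (-(κ * torusTreeLen X.1)) * (8 * (Real.exp 1 * 9 * 64 * K₀ 64 8 ^ 2) * (∑ i, 4 * A / ϱ i * |q i - hist' i|) +
          ΛE * |hist (Fin.last k) - hist' (Fin.last k)|) := by ring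
    _ ≤ Real.exp (-(κ * torusTreeLen X.1)) * ∑ i, Λ i * |hist i - hist' i| := mul_le_mul_of_nonneg_left hdom hexp

/-! ## §3 The OUTPUT-level last-coupling letter from an `EHoloAt`-shape datum (uniform discs) and from print's dilation shape (relative discs) -/

/-- **N09's CURRENCY ⟹ THE LETTER.**  An OUTPUT-level holomorphy datum in the LAST coupling of `EHoloAt` shape — per box prefix `g`, domain `X` and `φ ∈ sp X`: a
holomorphic extension of `t ↦ E^{(k+1)}(X; g|g_k := t; φ)` to a set containing the closed `r_E`-discs about `]0, γ]`, bounded by `B·e^{−κ_E d_{k+1}(X)}` ([I] p. 263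
«(or analytic)» with (1.18) on the margin) — gives the last-coupling letter with `Λ_E = 4B∕r_E` at every rate `κ ≤ κ_E` (`Dimock2015.real_param_lipschitz` through J31's
`norm_sub_update_le_of_coordHolo`). [cite: Balaban1987RG1, §1 p.263 (clause before (1.18)) with (1.18)] -/
theorem lastLetter_of_lastOutputHolo (S : ClusterStep (F.P K) 𝔸 M k) {γ : ℝ} (sp : (domSys (F.P K) M (k + 1)).Dom → Set (CPair (F.P K) 𝔸))
    {B κ κE rE : ℝ} (hB : 0 ≤ B) (hrE : 0 < rE) (hκE : κ ≤ κE)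
    (hL : ∀ g ∈ box γ k, ∀ (X : (domSys (F.P K) M (k + 1)).Dom), ∀ φ ∈ sp X,
      ∃ (Ec : ℂ → ℂ) (O : Set ℂ), DifferentiableOn ℂ Ec O ∧ (∀ t ∈ Ioc (0 : ℝ) γ, closedBall (t : ℂ) rE ⊆ O) ∧
        (∀ z ∈ O, ‖Ec z‖ ≤ B * Real.exp (-(κE * torusTreeLen X.1))) ∧
        (∀ t ∈ Ioc (0 : ℝ) γ, Ec t = S.E (Function.update g (Fin.last k) t) φ X)) :
    ∀ g ∈ box γ k, ∀ t ∈ Ioc (0 : ℝ) γ, ∀ (X : (domSys (F.P K) M (k + 1)).Dom), ∀ φ ∈ sp X,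
      ‖S.E g φ X - S.E (Function.update g (Fin.last k) t) φ X‖ ≤ 4 * B / rE * Real.exp (-(κ * torusTreeLen X.1)) * |g (Fin.last k) - t| := by
  intro g hg t ht X φ hφ
  obtain ⟨Ec, O, hhol, hdisc, hBd, hrep⟩ := hL g hg X φ hφ
  have hexp : Real.exp (-(κE * torusTreeLen X.1)) ≤ Real.exp (-(κ * torusTreeLen X.1)) :=
    Real.exp_le_exp.2 (neg_le_neg (mul_le_mul_of_nonneg_right hκE (torusTreeLen_nonneg _)))
  have h4 : 0 ≤ 4 * B / rE * |g (Fin.last k) - t| := by positivity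
  calc ‖S.E g φ X - S.E (Function.update g (Fin.last k) t) φ X‖
      ≤ 4 * (B * Real.exp (-(κE * torusTreeLen X.1))) / rE * |g (Fin.last k) - t| :=
        norm_sub_update_le_of_coordHolo (fun g => S.E g φ X) Set.ordConnected_Ioc hrE g (Fin.last k) (hg (Fin.last k)) Ec O hhol hdisc hBd hrep ht
    _ = 4 * B / rE * |g (Fin.last k) - t| * Real.exp (-(κE * torusTreeLen X.1)) := by ring
    _ ≤ 4 * B / rE * |g (Fin.last k) - t| * Real.exp (-(κ * torusTreeLen X.1)) := mul_le_mul_of_nonneg_left hexp h4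
    _ = 4 * B / rE * Real.exp (-(κ * torusTreeLen X.1)) * |g (Fin.last k) - t| := by ring

/-- **PRINT's DILATION SHAPE AT OUTPUT LEVEL ⟹ THE LETTER (vertex-aware edition).**  If instead the extension lives on the RELATIVE discs `D̄(s, c·s)`, `s ∈ ]0, γ]`, with a
bound `B′·s·e^{−κ_E d_{k+1}(X)}` vanishing linearly at the vertex (the cell's reading of the last coupling as a dilation parameter, (L5)∕[H-dil]; NOT a printed estimate), the
letter holds with `Λ_E = 8B′∕min(c,1)` (`T4CouplingAnalyticity.real_param_lipschitz_relW` through J31b's `norm_sub_update_le_of_coordHoloRel`). [cite: Balaban1987RG1, §1 p.263 (clause before (1.18)); Balaban1988RG2Cluster, (2.3) p.12] -/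
theorem lastLetter_of_lastOutputHoloRel (S : ClusterStep (F.P K) 𝔸 M k) {γ : ℝ} (sp : (domSys (F.P K) M (k + 1)).Dom → Set (CPair (F.P K) 𝔸))
    {B' c κ κE : ℝ} (hB' : 0 ≤ B') (hc : 0 < c) (hκE : κ ≤ κE)
    (hL : ∀ g ∈ box γ k, ∀ (X : (domSys (F.P K) M (k + 1)).Dom), ∀ φ ∈ sp X,
      ∃ (Ec : ℂ → ℂ) (O : Set ℂ), DifferentiableOn ℂ Ec O ∧ (∀ s ∈ Ioc (0 : ℝ) γ, closedBall (s : ℂ) (c * s) ⊆ O) ∧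
        (∀ s ∈ Ioc (0 : ℝ) γ, ∀ z ∈ closedBall (s : ℂ) (c * s), ‖Ec z‖ ≤ B' * s * Real.exp (-(κE * torusTreeLen X.1))) ∧
        (∀ s ∈ Ioc (0 : ℝ) γ, Ec s = S.E (Function.update g (Fin.last k) s) φ X)) :
    ∀ g ∈ box γ k, ∀ t ∈ Ioc (0 : ℝ) γ, ∀ (X : (domSys (F.P K) M (k + 1)).Dom), ∀ φ ∈ sp X,
      ‖S.E g φ X - S.E (Function.update g (Fin.last k) t) φ X‖ ≤
        8 * B' / min c 1 * Real.exp (-(κ * torusTreeLen X.1)) * |g (Fin.last k) - t| := by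
  intro g hg t ht X φ hφ
  obtain ⟨Ec, O, hhol, hdisc, hBd, hrep⟩ := hL g hg X φ hφ
  have hexp : Real.exp (-(κE * torusTreeLen X.1)) ≤ Real.exp (-(κ * torusTreeLen X.1)) :=
    Real.exp_le_exp.2 (neg_le_neg (mul_le_mul_of_nonneg_right hκE (torusTreeLen_nonneg _)))
  have hmin : 0 < min c 1 := lt_min hc one_pos
  have h8 : 0 ≤ 8 * B' / min c 1 * |g (Fin.last k) - t| := by positivity
  calc ‖S.E g φ X - S.E (Function.update g (Fin.last k) t) φ X‖
      ≤ 8 * (B' * Real.exp (-(κE * torusTreeLen X.1))) / min c 1 * |g (Fin.last k) - t| :=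
        norm_sub_update_le_of_coordHoloRel (fun g => S.E g φ X) hc g (Fin.last k) (hg (Fin.last k)) Ec O hhol hdisc
          (fun s hs z hz => (hBd s hs z hz).trans_eq (by ring)) hrep ht
    _ = 8 * B' / min c 1 * |g (Fin.last k) - t| * Real.exp (-(κE * torusTreeLen X.1)) := by ring
    _ ≤ 8 * B' / min c 1 * |g (Fin.last k) - t| * Real.exp (-(κ * torusTreeLen X.1)) := mul_le_mul_of_nonneg_left hexp h8
    _ = 8 * B' / min c 1 * Real.exp (-(κ * torusTreeLen X.1)) * |g (Fin.last k) - t| := by ring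

/-- **NON-VACUITY (A5 rider).**  The termless MODEL step (`idx Z = ∅`) carries the last-coupling letter for every `Λ_E ≥ 0` (its (2.13) terms do not read the couplings), and
J31's `coordHolo_termlessStep` ∕ `…N22W1YoungLipschitz.slots_termlessStep` carry the older margins ∕ `Bound238` — so §2, §4, §5 are not vacuous implications.  A model step,
NOT NODE 00's. [folklore] -/
theorem lastLetter_termlessStep {γ : ℝ} (sp : (domSys (F.P K) M (k + 1)).Dom → Set (CPair (F.P K) 𝔸)) {ΛE κ : ℝ} (hΛE : 0 ≤ ΛE) :
    ∀ g ∈ box γ k, ∀ t ∈ Ioc (0 : ℝ) γ, ∀ (X : (domSys (F.P K) M (k + 1)).Dom), ∀ φ ∈ sp X,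
      ‖(⟨PUnit, fun _ => ∅, fun _ _ _ => 0⟩ : ClusterStep (F.P K) 𝔸 M k).E g φ X -
          (⟨PUnit, fun _ => ∅, fun _ _ _ => 0⟩ : ClusterStep (F.P K) 𝔸 M k).E (Function.update g (Fin.last k) t) φ X‖ ≤
        ΛE * Real.exp (-(κ * torusTreeLen X.1)) * |g (Fin.last k) - t| := by
  intro g _ t _ X φ _
  have e : ∀ g' : Fin (k + 1) → ℝ, (⟨PUnit, fun _ => ∅, fun _ _ _ => 0⟩ : ClusterStep (F.P K) 𝔸 M k).E g' φ X =
      (⟨PUnit, fun _ => ∅, fun _ _ _ => 0⟩ : ClusterStep (F.P K) 𝔸 M k).E g φ X := fun g' =>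
    ClusterStep.E_congr _ (fun Z _ => by simp [ClusterStep.H])
  rw [e (Function.update g (Fin.last k) t), sub_self, norm_zero]
  positivity

end Engine

/-! ## §4 J29's soft windowed bound of the (1.7) localized sum with (N) from §2 and (C1) from the activities -/

/-- **REAL ARITHMETIC**: the soft summand `16·(e^{−κd}·L)∕r²·(w_z·w_0)` under the tails `w_z ≤ B₃e_z`, `w_0 ≤ B₃e_0` is at most `(16B₃²∕r²)·L′·e^{−κd}·e_z·e_0`
(`L = L′` the history modulus in its two spellings). [folklore] -/
theorem dichotomySummand_le_softMajorant {L L' r wz w0 B₃ ez e0 κ d : ℝ} (hL : 0 ≤ L) (hLL : L = L') (hr : 0 < r) (hB₃ : 0 ≤ B₃)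
    (hw0 : 0 ≤ w0) (hez : 0 ≤ ez) (hz : wz ≤ B₃ * ez) (h0 : w0 ≤ B₃ * e0) :
    16 * (Real.exp (-(κ * d)) * L) / r ^ 2 * (wz * w0) ≤ (16 * B₃ ^ 2 / r ^ 2) * L' * Real.exp (-κ * d) * ez * e0 := by
  subst hLL
  have h2 : wz * w0 ≤ (B₃ * ez) * (B₃ * e0) := mul_le_mul hz h0 hw0 (mul_nonneg hB₃ hez)
  have h3 : 0 ≤ 16 * (Real.exp (-(κ * d)) * L) / r ^ 2 := by positivity
  calc 16 * (Real.exp (-(κ * d)) * L) / r ^ 2 * (wz * w0)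
      ≤ 16 * (Real.exp (-(κ * d)) * L) / r ^ 2 * ((B₃ * ez) * (B₃ * e0)) := mul_le_mul_of_nonneg_left h2 h3
    _ = (16 * B₃ ^ 2 / r ^ 2) * L * Real.exp (-κ * d) * ez * e0 := by rw [neg_mul]; ring

section Window

variable {𝔄 : Type*} [NormedRing 𝔄] [NormedAlgebra ℝ 𝔄] {V : Type*} [NormedAddCommGroup V] [NormedSpace ℝ V] {ι' : Type*} [Fintype ι']
  {𝔸 : Type*} {M : ℕ} (F : T4Family) (S : (K : ℕ) → ClusterTower (F.P K) 𝔸 M) (emb : ReadingMaps F 𝔄 𝔸) (ρ : V →L[ℝ] 𝔄)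
  (bV : Module.Basis ι' ℝ V) (k K : ℕ) {Ec : Type*} [NormedAddCommGroup Ec] [NormedSpace ℂ Ec]

open Classical in
/-- **THE SOFT WINDOWED HISTORY-LIPSCHITZ BOUND OF THE (1.7) LOCALIZED SUM UNDER PRINT's DICHOTOMY.**  J29's `abs_polWindow_localizedSum_sub_le_soft` for two box prefixes
with (N) supplied by §2 at the complexified configurations `Φ_X z` (the reading maps the ball into the space of every polymer inside `X`) and (C1) — holomorphy of
`z ↦ E^{(k+1)}(X; hist; Φ_X z)` — from the ACTIVITIES' holomorphy through the reading (J30 v1.1, S25's parametric Kotecký–Preiss engine under `Bound238`).  Displayed: printed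
`Bound238` on the box, older-coordinate activity margins, the OUTPUT-level last-coupling letter, the readings' chart ∕ space clauses and site weights.
[cite: Balaban1987RG1, (1.7) p.261, (1.20)-(1.21) p.264, (4.35)-(4.37) pp.290-291 and (5.10) p.293; Balaban1988RG2Cluster, (2.3) p.12, (2.13) p.14, (2.38) p.20 and (2.39)-(2.41) p.21] -/
theorem abs_polWindow_localizedSum_sub_le_soft_of_dichotomy
    {γ : ℝ} (sp : (domSys (F.P K) M (k + 1)).Dom → Set (CPair (F.P K) 𝔸)) {A R r₁ κ ΛE : ℝ} (ϱ Λ : Fin (k + 1) → ℝ)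
    (hA : 0 < A) (hr₁ : 0 ≤ r₁) (hκ : κ ≤ r₁) (hrate : r₁ + 2 * (64 * Real.log 162) + 2 ≤ R)
    (hsmall : 2 * A * Real.exp (5 * r₁ + 1) * K₀ 64 8 * 9 * 64 ≤ 1) (hϱ : ∀ i, 0 < ϱ i)
    (hΛold : ∀ i : Fin (k + 1), (i : ℕ) < k → 8 * (Real.exp 1 * 9 * 64 * K₀ 64 8 ^ 2) * (4 * A / ϱ i) ≤ Λ i)
    (hΛlast : ΛE ≤ Λ (Fin.last k))
    (h238 : ((S K) k).Bound238 (box γ k) sp A R)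
    (hO : ∀ g ∈ box γ k, ∀ (Z : (domSys (F.P K) M (k + 1)).Dom), ∀ φ ∈ sp Z, ∀ i : Fin (k + 1), (i : ℕ) < k →
      ∃ (Hc : ℂ → ℂ) (O : Set ℂ), DifferentiableOn ℂ Hc O ∧ (∀ t ∈ Ioc (0 : ℝ) γ, closedBall (t : ℂ) (ϱ i) ⊆ O) ∧
        (∀ z ∈ O, ‖Hc z‖ ≤ A * Real.exp (-(R * (domSys (F.P K) M (k + 1)).dj Z))) ∧
        (∀ t ∈ Ioc (0 : ℝ) γ, Hc t = ((S K) k).H (Function.update g i t) φ Z))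
    (hlast : ∀ g ∈ box γ k, ∀ t ∈ Ioc (0 : ℝ) γ, ∀ (X : (domSys (F.P K) M (k + 1)).Dom), ∀ φ ∈ sp X,
      ‖((S K) k).E g φ X - ((S K) k).E (Function.update g (Fin.last k) t) φ X‖ ≤ ΛE * Real.exp (-(κ * torusTreeLen X.1)) * |g (Fin.last k) - t|)
    {hist hist' : Fin (k + 1) → ℝ} (hh : hist ∈ box γ k) (hh' : hist' ∈ box γ k)
    (ι : (domSys (F.P K) M (k + 1)).Dom → ((Fin (F.P K).d → Site (F.P K) (k + 1) → V) →L[ℝ] Ec))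
    (Φ : (domSys (F.P K) M (k + 1)).Dom → Ec → CPair (F.P K) 𝔸)
    (U : (domSys (F.P K) M (k + 1)).Dom → Set Ec) (hU : ∀ X, IsOpen (U X)) {r : ℝ} (hr : 0 < r) (hrU : ∀ X, ball (0 : Ec) r ⊆ U X)
    (hHhol : ∀ X (Z : (domSys (F.P K) M (k + 1)).Dom), Z.1 ⊆ X.1 → DifferentiableOn ℂ (fun z => ((S K) k).H hist (Φ X z) Z) (U X))
    (hHhol' : ∀ X (Z : (domSys (F.P K) M (k + 1)).Dom), Z.1 ⊆ X.1 → DifferentiableOn ℂ (fun z => ((S K) k).H hist' (Φ X z) Z) (U X))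
    (hΦemb : ∀ X (B : Fin (F.P K).d → Site (F.P K) (k + 1) → V), Φ X (ι X B) = emb K k (fun l t => NormedSpace.exp (ρ (B l t))))
    (hΦsp : ∀ X, ∀ z ∈ U X, ∀ Z : (domSys (F.P K) M (k + 1)).Dom, Z.1 ⊆ X.1 → Φ X z ∈ sp Z)
    (w : (domSys (F.P K) M (k + 1)).Dom → Site (F.P K) (k + 1) → ℝ)
    (hw₀ : ∀ X t, 0 ≤ w X t) (hw : ∀ X (l : Fin (F.P K).d) (t : Site (F.P K) (k + 1)) (c : ι'), ‖ι X (Pi.single l (Pi.single t (bV c)))‖ ≤ w X t)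
    (μ ν : Fin 4) (z : Fin 4 → ℤ) :
    |polWindow F K (k + 1) (localizedSum F S emb k hist K) ρ bV μ ν z - polWindow F K (k + 1) (localizedSum F S emb k hist' K) ρ bV μ ν z| ≤
      ∑ X : (domSys (F.P K) M (k + 1)).Dom,
        16 * (Real.exp (-(κ * torusTreeLen X.1)) * ∑ i, Λ i * |hist i - hist' i|) / r ^ 2 *
          (w X (siteOfInt F K (k + 1) z) * w X (siteOfInt F K (k + 1) 0)) := by
  have hK : 0 < K₀ 64 8 := K₀_pos 64 8
  have hsmall1 : A * Real.exp (5 * r₁ + 1) * K₀ 64 8 * 9 * 64 ≤ 1 := by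
    have h0 : 0 ≤ A * Real.exp (5 * r₁ + 1) * K₀ 64 8 * 9 * 64 := by have := hA.le; positivity
    linarith
  have key := fun (h : Fin (k + 1) → ℝ) (hm : h ∈ box γ k) (X : (domSys (F.P K) M (k + 1)).Dom)
      (hH : ∀ Z : (domSys (F.P K) M (k + 1)).Dom, Z.1 ⊆ X.1 → DifferentiableOn ℂ (fun z => ((S K) k).H h (Φ X z) Z) (U X)) =>
    (differentiableOn_and_norm_clusterStepE_comp_le_of_activityHol F K ((S K) k) (box γ k) sp hA.le hr₁ hrate hsmall1 h238 hm X (Φ X) (hU X)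
      hH (hΦsp X)).1
  exact abs_polWindow_localizedSum_sub_le_soft F S emb ρ bV k K hist hist' ι
    (fun X z => ((S K) k).E hist (Φ X z) X) (fun X z => ((S K) k).E hist' (Φ X z) X) U hU
    (fun X => key hist hh X (hHhol X)) (fun X => key hist' hh' X (hHhol' X)) hr hrU
    (fun X B => by rw [expChart_apply, hΦemb]) (fun X B => by rw [expChart_apply, hΦemb])
    (fun X => Real.exp (-(κ * torusTreeLen X.1)) * ∑ i, Λ i * |hist i - hist' i|)
    (fun X z hz => norm_clusterStepE_sub_le_of_olderCoordHolo_lastLetter F K ((S K) k) sp ϱ Λ hA hr₁ hκ hrate hsmall hϱ hΛold hΛlast h238 hO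
      hlast hh hh' X (fun Z hZ => hΦsp X z (hrU X hz) Z hZ))
    w hw₀ hw μ ν z

end Window

end YMDAG.N22.Dichotomy

end
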